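import Literature.NumberTheory.EllipticCurves.Curve346NontrivialSha
import Literature.NumberTheory.EllipticCurves.Curve6137TwoIsogenyDescent
import Literature.NumberTheory.EllipticCurves.TwoIsogenyCasselsParity
import HarnessLib

/-!
# `X = [0, -346, 0, 1369, 0]`: the OTHER isogeny Selmer group — `S^{(φ̂)} ⊆ {1, 37}` for the dual of
# `φ : X → X' = [0, 692, 0, 114240, 0]`, hence `#Ш(X'/ℚ)[φ̂] ≤ 2` (descent on the divisors of `21904 = 2⁴·37²`)

Topic `NumberTheory/EllipticCurves`. Fourth file of the rank-`2` isogeny-door cell `Curve346*`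
(`Curve346NontrivialSha`: `rank X(ℚ) = 2`, `t_2(X) = 0`, `#Ш(X/ℚ)[φ] = #(Ш(X) ∩ im Ξ_X) = 4`). The descent there
ran `X → X'` on the side `S^{(φ)}(X/ℚ) = S(692, 114240)` (`64` classes) and through the isogenous sharp curve `Y`.
Here the remaining Selmer group of the pair, read on the model `X'' = X'.twoIsogenyCodomain = [0, -1384, 0, 21904, 0]`
whose half-model is `X'` literally (`two_pow_twoIsogenySelmerRank_eq_natCard_mul_halfModel`):

* `twoIsogenySelmerGroup_X''_subset` — **`S(−1384, 21904) ⊆ {1, 37}`**: the squarefree divisors of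
  `21904 = 2⁴·37²` are `±1, ±2, ±37, ±74`; the negative ones die over `ℝ` (`a = −1384 ≤ 0`, `b > 0`), and `2`, `74`
  over `ℚ₂` (no solutions modulo `16` in either affine chart of `w² = d u⁴ − 1384 u²z² + (21904/d) z⁴`);
  `twoIsogenySelmerRank_X''_le_one` — `dim₂ ≤ 1`;
* `natCard_sha_inf_range_X'_le_two` — **`#(Ш(X'/ℚ) ∩ im Ξ_{X'}) ≤ 2`**, i.e. `#Ш(X')[φ_{X'}] = #ker Ш(φ̂) ≤ 2`
  (`2^{dim₂ S(−1384, 21904)} = #α(X''(ℚ)) · #(Ш(X') ∩ im Ξ_{X'})`), and it is `≥ 1` (finite, non-empty).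

§4 (appended) then decides the class `37` as well: it dies over `ℚ₅` (no solutions modulo `25`), so
`S(−1384, 21904) = {1}` and `Ш(X'/ℚ)[φ_{X'}] = 0` (`twoIsogenySelmerGroup_X''_eq`, `natCard_sha_inf_range_X'_eq_one`,
`sha_inf_range_X'_eq_bot`). In §1–§3 whether `37 ∈ S` is NOT decided and not needed by the first consumer
(`Summits/…/ShaPrimaryTransfer…OddDoorCurve346`: `4 ≤ #Ш(X/ℚ)[2] ≤ 4 · 2` and Cassels–Tate parity pin
`#Ш(X/ℚ)[2] = 4`). Theorems only; no definitions, no named facts; everything re-verified by the kernel.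

## References

* [SilvermanAEC2009] J. H. Silverman, *AEC*, 2nd ed.: Prop. X.4.9, Example X.4.10 (the congruence method),
  Thm. X.4.2(a).
* [SilvermanTate2015] J. H. Silverman, J. Tate, *Rational Points on Elliptic Curves*, §3.5–§3.6.
-/

noncomputable section

open scoped Classical

namespace Literature.NumberTheory.EllipticCurves

namespace Curve346

open _root_.WeierstrassCurve _root_.WeierstrassCurve.Affine

/-! ## 1. The model `X'' = [0, -1384, 0, 21904, 0]` and its half-model `X'` -/

/-- `b(a² − 4b) ≠ 0` for `(a, b) = (−1384, 21904)`. [cite: SilvermanAEC2009, Prop. X.4.9] -/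
theorem habX'' : (21904 : ℤ) * ((-1384 : ℤ) ^ 2 - 4 * 21904) ≠ 0 := by norm_num

/-- The tree's literal `E_{a,b}` for `(a,b) = (−1384, 21904)` is `X'' = [0, -1384, 0, 21904, 0]`.
[cite: SilvermanAEC2009, Prop. X.4.9] -/
theorem lit_X'' : (⟨0, ((-1384 : ℤ) : ℚ), 0, ((21904 : ℤ) : ℚ), 0⟩ : WeierstrassCurve ℚ) =
    ⟨0, -1384, 0, 21904, 0⟩ := by
  ext <;> push_cast <;> ring

/-- The half-model of `X''` is `X' = [0, 692, 0, 114240, 0]` literally. [cite: SilvermanAEC2009, Prop. X.4.9 and Remark X.4.9.1] -/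
theorem lit_halfModel_X'' :
    (⟨0, -((-1384 : ℤ) : ℚ) / 2, 0, (((-1384 : ℤ) : ℚ) ^ 2 - 4 * (21904 : ℤ)) / 16, 0⟩ : WeierstrassCurve ℚ) =
      ⟨0, 692, 0, 114240, 0⟩ := by
  ext <;> push_cast <;> ring

/-- `X'' = X'.twoIsogenyCodomain`. [cite: SilvermanAEC2009, III.4.5 (the explicit 2-isogeny)] -/
theorem twoIsogenyCodomain_X' :
    (⟨0, 692, 0, 114240, 0⟩ : WeierstrassCurve ℚ).twoIsogenyCodomain = ⟨0, -1384, 0, 21904, 0⟩ := by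
  rw [← lit_halfModel_X'', twoIsogenyCodomain_halfModel, lit_X'']

/-- `X'' = [0, -1384, 0, 21904, 0]` is an elliptic curve. [cite: SilvermanAEC2009, Prop. X.4.9] -/
theorem isElliptic_X'' : (⟨0, -1384, 0, 21904, 0⟩ : WeierstrassCurve ℚ).IsElliptic := by
  rw [← lit_X'']; exact isElliptic_mk_of_ne_zero (F := ℚ) habX''

/-! ## 2. `S(−1384, 21904) ⊆ {1, 37}` -/

/-- A squarefree integer dividing `21904 = 2⁴·37²` is `±` a divisor of `74 = 2·37`: one of
`±1, ±2, ±37, ±74`. [folklore] -/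
private theorem mem_of_dvd_b'' {d : ℤ} (hsq : Squarefree d) (hd : d ∣ 21904) :
    d ∈ ({1, -1, 2, -2, 37, -37, 74, -74} : Finset ℤ) := by
  have h74 : d ∣ 74 := by
    have h4 : d ∣ (74 : ℤ) ^ 4 := dvd_trans hd ⟨1369, by norm_num⟩
    exact (hsq.dvd_pow_iff_dvd (by norm_num)).mp h4
  have h1 : d.natAbs ∣ 74 := by
    have := Int.natAbs_dvd_natAbs.mpr h74
    simpa using this
  have h2 : d.natAbs ∈ Nat.divisors 74 := Nat.mem_divisors.mpr ⟨h1, by norm_num⟩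
  rw [show Nat.divisors 74 = {1, 2, 37, 74} by decide] at h2
  simp only [Finset.mem_insert, Finset.mem_singleton] at h2
  rcases Int.natAbs_eq d with h | h <;> rw [h] <;> rcases h2 with h2 | h2 | h2 | h2 <;> simp [h2]

/-- `S(−1384, 21904)` does not contain `2` nor `74`: `w² = 2u⁴ − 1384u²z² + 10952z⁴` and
`w² = 74u⁴ − 1384u²z² + 296z⁴` have no solutions modulo `16` in either chart.
[cite: SilvermanAEC2009, Example X.4.10 (the congruence method)] -/
theorem not_mem_S'' :
    (2 : ℤ) ∉ twoIsogenySelmerGroup (-1384) 21904 ∧ (74 : ℤ) ∉ twoIsogenySelmerGroup (-1384) 21904 := by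
  have hB : (21904 : ℤ) ≠ 0 := by norm_num
  haveI : Fact (Nat.Prime 2) := ⟨Nat.prime_two⟩
  refine ⟨?_, ?_⟩
  · refine Carrier6137.not_mem_twoIsogenySelmerGroup_of_not_isSoluble hB 2 ?_
    rw [show (21904 : ℤ) / 2 = 10952 by norm_num]
    exact Carrier6137.not_isSoluble_padic_twoIsogenyQuartic_of_zmodPow 4 (by decide)
  · refine Carrier6137.not_mem_twoIsogenySelmerGroup_of_not_isSoluble hB 2 ?_
    rw [show (21904 : ℤ) / 74 = 296 by norm_num]
    exact Carrier6137.not_isSoluble_padic_twoIsogenyQuartic_of_zmodPow 4 (by decide)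

/-- **`S^{(φ̂)} = S(−1384, 21904) ⊆ {1, 37}`**: negative classes die over `ℝ` (`b > 0`, `a ≤ 0`), `2` and `74`
over `ℚ₂`. [cite: SilvermanAEC2009, Prop. X.4.9 and Example X.4.10] -/
theorem twoIsogenySelmerGroup_X''_subset :
    twoIsogenySelmerGroup (-1384) 21904 ⊆ ({1, 37} : Finset ℤ) := by
  intro d hd
  obtain ⟨hsq, hdvd, hloc⟩ := (mem_twoIsogenySelmerGroup_iff (a := -1384) (by norm_num : (21904 : ℤ) ≠ 0)).mp hd
  have hdpos : 0 < d := by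
    rcases lt_trichotomy d 0 with hneg | h0 | hpos
    · exfalso
      have hquot : (21904 : ℤ) / d < 0 := by
        obtain ⟨k, hk⟩ := hdvd
        rw [hk, Int.mul_ediv_cancel_left _ hneg.ne]
        nlinarith
      exact not_isSoluble_real_twoIsogenyQuartic_of_neg hneg hquot (by norm_num) hloc.1
    · exact absurd h0 hsq.ne_zero
    · exact hpos
  have hmem := mem_of_dvd_b'' hsq hdvd
  obtain ⟨h2, h74⟩ := not_mem_S''
  simp only [Finset.mem_insert, Finset.mem_singleton] at hmem ⊢
  rcases hmem with rfl | rfl | rfl | rfl | rfl | rfl | rfl | rfl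
  · exact Or.inl rfl
  · norm_num at hdpos
  · exact absurd hd h2
  · norm_num at hdpos
  · exact Or.inr rfl
  · norm_num at hdpos
  · exact absurd hd h74
  · norm_num at hdpos

/-- **`dim₂ S^{(φ̂)} = dim₂ S(−1384, 21904) ≤ 1`.** [cite: SilvermanAEC2009, Prop. X.4.9] -/
theorem twoIsogenySelmerRank_X''_le_one : twoIsogenySelmerRank (-1384) 21904 ≤ 1 := by
  apply (Nat.pow_le_pow_iff_right (by norm_num : 1 < 2)).mp
  rw [two_pow_twoIsogenySelmerRank_eq_card habX'', pow_one]
  exact (Finset.card_le_card twoIsogenySelmerGroup_X''_subset).trans (by decide)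

/-! ## 3. `#Ш(X'/ℚ)[φ_{X'}] = #(Ш(X') ∩ im Ξ_{X'}) ≤ 2` -/

/-- **`1 ≤ #(Ш(X'/ℚ) ∩ im Ξ_{X'}) ≤ 2`** for `X' = [0, 692, 0, 114240, 0]`: Silverman's count
`2^{dim₂ S(−1384, 21904)} = #α(X''(ℚ)) · #(Ш(X') ∩ im Ξ_{X'})` (`two_pow_twoIsogenySelmerRank_eq_natCard_mul_halfModel`,
half-model of `X''` = `X'`) with `dim₂ ≤ 1`. [cite: SilvermanAEC2009, Thm. X.4.2(a) and Prop. X.4.9] -/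
theorem natCard_sha_inf_range_X'_le_two [hE' : (⟨0, 692, 0, 114240, 0⟩ : WeierstrassCurve ℚ).IsElliptic] :
    1 ≤ Nat.card ↥((⟨0, 692, 0, 114240, 0⟩ : WeierstrassCurve ℚ).sha ⊓
        AddMonoidHom.range (G := Additive (SqUnits ℚ)) (⟨0, 692, 0, 114240, 0⟩ : WeierstrassCurve ℚ).twoIsogenyTorsorHom) ∧
      Nat.card ↥((⟨0, 692, 0, 114240, 0⟩ : WeierstrassCurve ℚ).sha ⊓
        AddMonoidHom.range (G := Additive (SqUnits ℚ)) (⟨0, 692, 0, 114240, 0⟩ : WeierstrassCurve ℚ).twoIsogenyTorsorHom) ≤ 2 := by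
  haveI hV₀ : (⟨0, -((-1384 : ℤ) : ℚ) / 2, 0, (((-1384 : ℤ) : ℚ) ^ 2 - 4 * (21904 : ℤ)) / 16, 0⟩ :
      WeierstrassCurve ℚ).IsElliptic := by
    rw [lit_halfModel_X'']; exact hE'
  have key := two_pow_twoIsogenySelmerRank_eq_natCard_mul_halfModel (a := -1384) (b := 21904) habX''
  rw [natCard_sha_inf_range_twoIsogenyTorsorHom_congr lit_halfModel_X''] at key
  have hle : 2 ^ twoIsogenySelmerRank (-1384) 21904 ≤ 2 ^ 1 :=
    Nat.pow_le_pow_right (by norm_num) twoIsogenySelmerRank_X''_le_one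
  have hpos : 0 < 2 ^ twoIsogenySelmerRank (-1384) 21904 := by positivity
  rw [key] at hle hpos
  rw [pow_one] at hle
  set m := Nat.card (Set.range (⟨0, ((-1384 : ℤ) : ℚ), 0, ((21904 : ℤ) : ℚ), 0⟩ : WeierstrassCurve ℚ).xSqClass)
  set n := Nat.card ↥((⟨0, 692, 0, 114240, 0⟩ : WeierstrassCurve ℚ).sha ⊓
        AddMonoidHom.range (G := Additive (SqUnits ℚ)) (⟨0, 692, 0, 114240, 0⟩ : WeierstrassCurve ℚ).twoIsogenyTorsorHom)
  have hm : 0 < m := Nat.pos_of_mul_pos_right hpos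
  have hn : 0 < n := Nat.pos_of_mul_pos_left hpos
  refine ⟨hn, ?_⟩
  nlinarith

/-! ## 4. (appended) The class `37` dies over `ℚ₅`: `S(−1384, 21904) = {1}`, `Ш(X'/ℚ)[φ_{X'}] = 0` -/

/-- `37 ∉ S(−1384, 21904)`: `w² = 37u⁴ − 1384u²z² + 592z⁴` has no solutions modulo `25` in either chart
(modulo `5` it has; the obstruction is at the second step). [cite: SilvermanAEC2009, Example X.4.10 (the congruence method)] -/
theorem not_mem_S''_37 : (37 : ℤ) ∉ twoIsogenySelmerGroup (-1384) 21904 := by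
  have hB : (21904 : ℤ) ≠ 0 := by norm_num
  haveI : Fact (Nat.Prime 5) := ⟨by norm_num⟩
  refine Carrier6137.not_mem_twoIsogenySelmerGroup_of_not_isSoluble hB 5 ?_
  rw [show (21904 : ℤ) / 37 = 592 by norm_num]
  exact Carrier6137.not_isSoluble_padic_twoIsogenyQuartic_of_zmodPow 2 (by decide)

/-- **`S^{(φ̂)} = S(−1384, 21904) = {1}`** (the class `1` is always present). [cite: SilvermanAEC2009, Prop. X.4.9] -/
theorem twoIsogenySelmerGroup_X''_eq : twoIsogenySelmerGroup (-1384) 21904 = ({1} : Finset ℤ) := by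
  refine Finset.Subset.antisymm (fun d hd ↦ ?_) (fun d hd ↦ ?_)
  · have h := twoIsogenySelmerGroup_X''_subset hd
    simp only [Finset.mem_insert, Finset.mem_singleton] at h ⊢
    rcases h with rfl | rfl
    · rfl
    · exact absurd hd not_mem_S''_37
  · simp only [Finset.mem_singleton] at hd
    subst hd
    exact one_mem_twoIsogenySelmerGroup (-1384) (by norm_num : (21904 : ℤ) ≠ 0)

/-- **`dim₂ S(−1384, 21904) = 0`.** [cite: SilvermanAEC2009, Prop. X.4.9] -/
theorem twoIsogenySelmerRank_X''_eq_zero : twoIsogenySelmerRank (-1384) 21904 = 0 := by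
  have h := two_pow_twoIsogenySelmerRank_eq_card habX''
  rw [twoIsogenySelmerGroup_X''_eq, Finset.card_singleton] at h
  exact (Nat.pow_eq_one.mp h).resolve_left (by norm_num)

/-- **`#(Ш(X'/ℚ) ∩ im Ξ_{X'}) = 1`**: `Ш(X')[φ_{X'}] = ker Ш(φ̂) = 0` for `X' = [0, 692, 0, 114240, 0]` — the sharp form
of §3 (`2^0 = #α(X''(ℚ)) · #(Ш(X') ∩ im Ξ_{X'})`). [cite: SilvermanAEC2009, Thm. X.4.2(a) and Prop. X.4.9] -/
theorem natCard_sha_inf_range_X'_eq_one [hE' : (⟨0, 692, 0, 114240, 0⟩ : WeierstrassCurve ℚ).IsElliptic] :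
    Nat.card ↥((⟨0, 692, 0, 114240, 0⟩ : WeierstrassCurve ℚ).sha ⊓
        AddMonoidHom.range (G := Additive (SqUnits ℚ)) (⟨0, 692, 0, 114240, 0⟩ : WeierstrassCurve ℚ).twoIsogenyTorsorHom) = 1 := by
  haveI hV₀ : (⟨0, -((-1384 : ℤ) : ℚ) / 2, 0, (((-1384 : ℤ) : ℚ) ^ 2 - 4 * (21904 : ℤ)) / 16, 0⟩ :
      WeierstrassCurve ℚ).IsElliptic := by
    rw [lit_halfModel_X'']; exact hE'
  have key := two_pow_twoIsogenySelmerRank_eq_natCard_mul_halfModel (a := -1384) (b := 21904) habX''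
  rw [natCard_sha_inf_range_twoIsogenyTorsorHom_congr lit_halfModel_X'', twoIsogenySelmerRank_X''_eq_zero,
    pow_zero] at key
  exact (Nat.eq_one_of_mul_eq_one_left key.symm)

/-- **`Ш(X'/ℚ) ∩ im Ξ_{X'} = ⊥`** (subgroup form of `Ш(X')[φ_{X'}] = 0`). [cite: SilvermanAEC2009, Thm. X.4.2(a)] -/
theorem sha_inf_range_X'_eq_bot [hE' : (⟨0, 692, 0, 114240, 0⟩ : WeierstrassCurve ℚ).IsElliptic] :
    (⟨0, 692, 0, 114240, 0⟩ : WeierstrassCurve ℚ).sha ⊓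
        AddMonoidHom.range (G := Additive (SqUnits ℚ)) (⟨0, 692, 0, 114240, 0⟩ : WeierstrassCurve ℚ).twoIsogenyTorsorHom = ⊥ :=
  AddSubgroup.eq_bot_of_card_eq _ natCard_sha_inf_range_X'_eq_one

end Curve346

end Literature.NumberTheory.EllipticCurves

end
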